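import Literature.Analysis.FluidPDE.AgeDecouplingGridData
import Literature.Analysis.FluidPDE.AgeDecouplingGridStep
import HarnessLib

/-!
# Grid age decoupling, V: the window inequality (H2) for a.e. observation time

Analysis/FluidPDE proof-support file (everything proved). For `κ > 0`, a GLOBAL weak solution `θ` of
the steadily sourced equation `∂ₜθ + u·∇θ = κΔθ + h` over a drift with `∫₀ᵀ ‖∇u‖_{L²} < ∞` and
`t ↦ ∫‖u(t)‖²` locally integrable, a mesh `0 < δ ≤ S/2` and a countable family `ϑ_n` of bounded weak
releases of `h` at the grid times `s_n = δ(n+1)` into `u(s_n + ·)` on `[0, S+1)` with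
`∫ ϑ_n(τ)² ≤ ∫ h²` a.e., the window inequality (H2) of the age-decoupling argument
(`AgeDecoupling.longTimeAvgSup_le_of_window`) holds for a.e. `t > S + δ` with an explicit slack of
size `O(δ)` (`ae_window_ineq`):

  `∫_{t-S}^t P ≤ ‖θ(t)‖²/2 + 2 (∫_{t-S}^t κ‖∇θ‖²)^{1/2} (∫_{t-S}^t w) + (∫_{t-S}^t w)² + b(t)`,

`P` the trace of the power input, `w` the grid step function with value `√D_n` on the cell
`(δn, δ(n+1)]` (`D_n = (eScalarDissipation κ ϑ_n 0 S).toReal`), and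
`b(t) = ∫_{t-S}^{t-S+δ} f + ∫_{t-δ}^t f + δ ∫_{t-S}^t k_θ + (3/2)δS H₂ + 2δS (c₀ S + (C_∇/2)∫_{t-S}^t ‖u‖²)`
with `f = (1 + H₂‖θ‖²)/2`, `k_θ = C_∇(‖θ‖² + ‖u‖²)/2 + κC_Δ(1 + ‖θ‖²)/2 + H₂`,
`c₀ = C_∇H₂/2 + κC_Δ(1 + H₂)/2`, `H₂ = ∫h²`.

Proof: at an observation time `t` at which the countably many a.e. statements of
`AgeDecouplingGridPairing` hold (pairings (P1), (P2), slices in `L²`) and which is not a grid point,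
count the grid points in `[t - S + δ, t)` (`AgeDecoupling.grid_count`) and feed the finite-sum
assembly `AgeDecoupling.window_ineq_of_grid` with the deterministic data of
`AgeDecouplingGridData`. No single printed source (Duhamel superposition + Cauchy–Schwarz
bookkeeping in the spirit of Doering–Foias 2002 §2 and DEIJ 2022 (1.2)–(1.3)). [folklore]
-/

noncomputable section

open _root_.MeasureTheory _root_.Set _root_.Filter _root_.Function _root_.TopologicalSpace
open scoped ENNReal NNReal InnerProductSpace

namespace Literature.Analysis.FluidPDE

namespace Torus

variable {d : Type*} [Fintype d]

section Window

variable {κ δ S B Cg Cl : ℝ} {u : ℝ → UnitAddTorus d → EuclideanSpace ℝ d} {h θ₀ : UnitAddTorus d → ℝ}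
  {θ : ℝ → UnitAddTorus d → ℝ} {ϑ : ℕ → ℝ → UnitAddTorus d → ℝ}

/-! ## Deterministic pieces at one observation time -/

/-- **The data of one grid release at the observation time `t`**: for the release started at
`s_n = δ(n+1)` with age `ℓ = t - s_n ∈ [0, S]`, `S ≤ t`: the majorant `k_n` and the trace `P_n` are
interval integrable on `[0, ℓ]`, the trace has modulus `k_n`, and
`∫₀^ℓ k_n ≤ c₀ S + (C_∇/2) ∫_{t-S}^t ‖u‖²` (`releaseTrace_data`, the energy window being moved inside
`(t - S, t]`). [folklore] -/
theorem release_data_at (hκ : 0 < κ) (hh : FunctionSpaces.Torus.IsSmooth h)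
    (hCg : ∀ x, ‖FunctionSpaces.Torus.gradient h x‖ ≤ Cg) (hCl : ∀ x, |FunctionSpaces.Torus.laplacian h x| ≤ Cl)
    (hEu : ∀ T, 0 < T → IntegrableOn (fun s => ∫ y, ‖u s y‖ ^ 2) (Ioc 0 T) volume)
    (hδ : 0 < δ) {t : ℝ} {n : ℕ} {R : ℝ → UnitAddTorus d → ℝ}
    (hR : IsWeakScalarTransportOn (S + 1) κ (fun τ => u (δ * (n + 1) + τ)) h R)
    (hsqR : ∀ᵐ τ ∂((volume : Measure ℝ).restrict (Ioo 0 (S + 1))), ∫⁻ x, ‖R τ x‖ₑ ^ 2 ≤ eLpNorm h 2 volume ^ 2)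
    (hage0 : 0 ≤ t - δ * (n + 1)) (hageS : t - δ * (n + 1) ≤ S) (htS : S ≤ t) :
    IntervalIntegrable (fun r => Cg * ((∫ y, h y ^ 2) + ∫ y, ‖u (δ * (n + 1) + r) y‖ ^ 2) / 2 +
        κ * Cl * (1 + ∫ y, h y ^ 2) / 2) volume 0 (t - δ * (n + 1)) ∧
      IntervalIntegrable (fun s => (∫ y, h y * h y) + ∫ r in Ioc 0 s, ∫ y, R r y *
        (⟪u (δ * (n + 1) + r) y, FunctionSpaces.Torus.gradient h y⟫_ℝ + κ * FunctionSpaces.Torus.laplacian h y))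
        volume 0 (t - δ * (n + 1)) ∧
      (∀ s₁ s₂, 0 ≤ s₁ → s₁ ≤ s₂ → s₂ ≤ t - δ * (n + 1) →
        |((∫ y, h y * h y) + ∫ r in Ioc 0 s₂, ∫ y, R r y *
            (⟪u (δ * (n + 1) + r) y, FunctionSpaces.Torus.gradient h y⟫_ℝ + κ * FunctionSpaces.Torus.laplacian h y)) -
          ((∫ y, h y * h y) + ∫ r in Ioc 0 s₁, ∫ y, R r y *
            (⟪u (δ * (n + 1) + r) y, FunctionSpaces.Torus.gradient h y⟫_ℝ + κ * FunctionSpaces.Torus.laplacian h y))| ≤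
          ∫ r in s₁..s₂, (Cg * ((∫ y, h y ^ 2) + ∫ y, ‖u (δ * (n + 1) + r) y‖ ^ 2) / 2 + κ * Cl * (1 + ∫ y, h y ^ 2) / 2)) ∧
      ∫ r in (0 : ℝ)..(t - δ * (n + 1)), (Cg * ((∫ y, h y ^ 2) + ∫ y, ‖u (δ * (n + 1) + r) y‖ ^ 2) / 2 +
          κ * Cl * (1 + ∫ y, h y ^ 2) / 2) ≤
        (Cg * (∫ y, h y ^ 2) / 2 + κ * Cl * (1 + ∫ y, h y ^ 2) / 2) * S + Cg / 2 * ∫ s in (t - S)..t, ∫ y, ‖u s y‖ ^ 2 := by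
  have hCg0 : 0 ≤ Cg := (norm_nonneg _).trans (hCg 0)
  have hCl0 : 0 ≤ Cl := (abs_nonneg _).trans (hCl 0)
  have hH20 : 0 ≤ ∫ y, h y ^ 2 := integral_nonneg fun _ => sq_nonneg _
  have hσ0 : 0 ≤ δ * (n + 1) := by positivity
  have hδn : δ ≤ δ * (n + 1) := by nlinarith [(Nat.cast_nonneg n : (0 : ℝ) ≤ n)]
  have ht0 : 0 < t := by linarith
  obtain ⟨h1, h2, h3, h4⟩ := hR.releaseTrace_data hκ.le hσ0 hh hCg hCl hsqR hEu hage0 (by linarith : t - δ * (n + 1) ≤ S + 1)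
  refine ⟨h1, h2, h3, ?_⟩
  rw [h4, add_sub_cancel]
  have hK0 : 0 ≤ Cg * (∫ y, h y ^ 2) / 2 + κ * Cl * (1 + ∫ y, h y ^ 2) / 2 :=
    add_nonneg (div_nonneg (mul_nonneg hCg0 hH20) zero_le_two)
      (div_nonneg (mul_nonneg (mul_nonneg hκ.le hCl0) (by linarith)) zero_le_two)
  have hE : ∫ s in (δ * (n + 1))..t, ∫ y, ‖u s y‖ ^ 2 ≤ ∫ s in (t - S)..t, ∫ y, ‖u s y‖ ^ 2 := by
    refine intervalIntegral.integral_mono_interval (by linarith) (by linarith) le_rfl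
      (ae_of_all _ fun s => integral_nonneg fun _ => sq_nonneg _) ?_
    exact (intervalIntegrable_iff_integrableOn_Ioc_of_le (by linarith)).2
      ((hEu t ht0).mono_set (Ioc_subset_Ioc_left (by linarith)))
  have hA := mul_le_mul_of_nonneg_left hageS hK0
  have hB' := mul_le_mul_of_nonneg_left hE (div_nonneg hCg0 zero_le_two)
  linarith

/-- **The end bits of the window**: if the cells `(x₀, x₁]` of the grid points satisfy
`t - S ≤ x₀ ≤ t - S + δ` and `t - δ ≤ x₁ ≤ t`, then
`∫_{t-S}^t P - ∫_{x₀}^{x₁} P ≤ ∫_{t-S}^{t-S+δ} f + ∫_{t-δ}^t f`, `f = (1 + H₂‖θ‖²)/2 ≥ |P|` a.e.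
[folklore] -/
theorem window_sub_cells_le (hθ : IsWeakScalarTransportForced κ u (fun _ => h) θ₀ θ)
    (hh : FunctionSpaces.Torus.IsSmooth h) {t x₀ x₁ : ℝ} (htS : 0 ≤ t - S) (hx₀ : t - S ≤ x₀) (hx₀₁ : x₀ ≤ x₁)
    (hx₁ : x₁ ≤ t) (hx₀' : x₀ ≤ t - S + δ) (hδt : 0 ≤ t - δ) (hx₁' : t - δ ≤ x₁) :
    (∫ s in (t - S)..t, ((∫ y, θ₀ y * h y) + ∫ τ in Ioc 0 s, ((∫ y, θ τ y *
        (⟪u τ y, FunctionSpaces.Torus.gradient h y⟫_ℝ + κ * FunctionSpaces.Torus.laplacian h y)) + ∫ y, h y * h y))) -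
      ∫ s in x₀..x₁, ((∫ y, θ₀ y * h y) + ∫ τ in Ioc 0 s, ((∫ y, θ τ y *
        (⟪u τ y, FunctionSpaces.Torus.gradient h y⟫_ℝ + κ * FunctionSpaces.Torus.laplacian h y)) + ∫ y, h y * h y)) ≤
      (∫ s in (t - S)..(t - S + δ), (1 + (∫ y, h y ^ 2) * scalarL2Sq (θ s)) / 2) +
        ∫ s in (t - δ)..t, (1 + (∫ y, h y ^ 2) * scalarL2Sq (θ s)) / 2 := by
  have hH20 : 0 ≤ ∫ y, h y ^ 2 := integral_nonneg fun _ => sq_nonneg _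
  have hFint : ∀ a b, 0 ≤ a → a ≤ b → IntervalIntegrable (fun s => (1 + (∫ y, h y ^ 2) * scalarL2Sq (θ s)) / 2) volume a b := by
    intro a b ha hab
    have hi : IntegrableOn (fun s => (1 + (∫ y, h y ^ 2) * scalarL2Sq (θ s)) / 2) (Ioc 0 (b + 1)) volume :=
      ((integrableOn_const (measure_Ioc_lt_top (a := (0 : ℝ)) (b := b + 1)).ne).add
        ((integrableOn_scalarL2Sq hθ (by linarith)).1.const_mul _)).div_const 2
    exact (intervalIntegrable_iff_integrableOn_Ioc_of_le hab).2 (hi.mono_set (Ioc_subset_Ioc ha (by linarith)))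
  have hF0 : ∀ s, 0 ≤ (1 + (∫ y, h y ^ 2) * scalarL2Sq (θ s)) / 2 := fun s =>
    div_nonneg (add_nonneg zero_le_one (mul_nonneg hH20 (integral_nonneg fun _ => sq_nonneg _))) zero_le_two
  have hPint : ∀ a b, 0 ≤ a → a ≤ b → IntervalIntegrable (fun s => (∫ y, θ₀ y * h y) + ∫ τ in Ioc 0 s, ((∫ y, θ τ y *
      (⟪u τ y, FunctionSpaces.Torus.gradient h y⟫_ℝ + κ * FunctionSpaces.Torus.laplacian h y)) + ∫ y, h y * h y)) volume a b :=
    fun a b ha hab => ((continuousOn_trace hθ hh b).mono (Icc_subset_Icc_left ha)).intervalIntegrable_of_Icc hab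
  have i1 := hPint (t - S) x₀ htS hx₀
  have i2 := hPint x₀ x₁ (htS.trans hx₀) hx₀₁
  have i3 := hPint x₁ t ((htS.trans hx₀).trans hx₀₁) hx₁
  have hsplit1 := intervalIntegral.integral_add_adjacent_intervals i1 i2
  have hsplit2 := intervalIntegral.integral_add_adjacent_intervals (i1.trans i2) i3
  have hl := integral_trace_le_integral_majorant hθ hh htS hx₀
  have hl' : ∫ s in (t - S)..x₀, (1 + (∫ y, h y ^ 2) * scalarL2Sq (θ s)) / 2 ≤
      ∫ s in (t - S)..(t - S + δ), (1 + (∫ y, h y ^ 2) * scalarL2Sq (θ s)) / 2 :=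
    intervalIntegral.integral_mono_interval le_rfl hx₀ hx₀' (ae_of_all _ hF0) (hFint _ _ htS (hx₀.trans hx₀'))
  have hr := integral_trace_le_integral_majorant hθ hh ((htS.trans hx₀).trans hx₀₁) hx₁
  have hr' : ∫ s in x₁..t, (1 + (∫ y, h y ^ 2) * scalarL2Sq (θ s)) / 2 ≤
      ∫ s in (t - δ)..t, (1 + (∫ y, h y ^ 2) * scalarL2Sq (θ s)) / 2 :=
    intervalIntegral.integral_mono_interval hx₁' hx₁ le_rfl (ae_of_all _ hF0) (hFint _ _ hδt (by linarith))
  linarith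

omit [Fintype d] in
/-- **The release weights over the grid points are a window of the grid step function**:
`δ ∑_{j<L} √c(i₀ - 1 + j) ≤ ∫ₐᵇ w` whenever the cells `(δi₀ - δ, δi₀ - δ + δL]` lie in `[a, b]`
(`w` the grid step function of `√c`, `|√c| ≤ C`). [folklore] -/
theorem mul_sum_sqrt_le_window {c : ℕ → ℝ} {C a b : ℝ} (hδ : 0 < δ) (hC : 0 ≤ C) (hcC : ∀ n, |Real.sqrt (c n)| ≤ C)
    {i₀ : ℕ} (hi₀ : 1 ≤ i₀) (L : ℕ) (ha : a ≤ δ * i₀ - δ) (hb : δ * i₀ - δ + δ * L ≤ b) :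
    δ * ∑ j ∈ Finset.range L, Real.sqrt (c (i₀ - 1 + j)) ≤
      ∫ s in a..b, (if 0 < s then Real.sqrt (c (⌈s / δ⌉₊ - 1)) else 0) := by
  have hcells := AgeDecoupling.integral_gridFun_cells (c := fun n => Real.sqrt (c n)) hδ hC hcC hi₀ L
  have e : δ * ∑ j ∈ Finset.range L, Real.sqrt (c (i₀ - 1 + j)) =
      ∫ s in (δ * i₀ - δ)..(δ * i₀ - δ + δ * L), if 0 < s then Real.sqrt (c (⌈s / δ⌉₊ - 1)) else 0 := hcells.symm
  rw [e]
  refine intervalIntegral.integral_mono_interval ha (le_add_of_nonneg_right (by positivity)) hb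
    (ae_of_all _ fun s => ?_) ?_
  · exact AgeDecoupling.gridFun_nonneg (c := fun n => Real.sqrt (c n)) (δ := δ) (fun n => Real.sqrt_nonneg _) s
  · exact AgeDecoupling.intervalIntegrable_gridFun (c := fun n => Real.sqrt (c n)) (δ := δ) hC hcC _ _

/-! ## The window inequality -/

/-- **The grid window inequality (H2), a.e. in the observation time** (see the module docstring for
the statement and the notation). [folklore] -/
theorem ae_window_ineq (hκ : 0 < κ)
    (hθ : IsWeakScalarTransportForced κ u (fun _ => h) θ₀ θ) (hθ₀ : MemLp θ₀ 2 volume)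
    (hh : FunctionSpaces.Torus.IsSmooth h)
    (hCg : ∀ x, ‖FunctionSpaces.Torus.gradient h x‖ ≤ Cg) (hCl : ∀ x, |FunctionSpaces.Torus.laplacian h x| ≤ Cl)
    (hG : ∀ T, 0 < T → ∫⁻ t in Ioo 0 T, FunctionSpaces.Torus.eGradNormSq (u t) ^ (1 / 2 : ℝ) < ⊤)
    (hEu : ∀ T, 0 < T → IntegrableOn (fun s => ∫ y, ‖u s y‖ ^ 2) (Ioc 0 T) volume)
    (hδ : 0 < δ) (hδS : 2 * δ ≤ S)
    (hrel : ∀ n : ℕ, IsWeakScalarTransportOn (S + 1) κ (fun τ => u (δ * (n + 1) + τ)) h (ϑ n))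
    (hB : ∀ n : ℕ, ∀ᵐ τ ∂((volume : Measure ℝ).restrict (Ioo 0 (S + 1))),
      ∀ᵐ x ∂(volume : Measure (UnitAddTorus d)), |ϑ n τ x| ≤ B)
    (hsq : ∀ n : ℕ, ∀ᵐ τ ∂((volume : Measure ℝ).restrict (Ioo 0 (S + 1))),
      ∫⁻ x, ‖ϑ n τ x‖ₑ ^ 2 ≤ eLpNorm h 2 volume ^ 2) :
    ∀ᵐ t ∂((volume : Measure ℝ).restrict (Ioi (S + δ))),
      ∫ s in (t - S)..t, ((∫ y, θ₀ y * h y) + ∫ τ in Ioc 0 s, ((∫ y, θ τ y *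
          (⟪u τ y, FunctionSpaces.Torus.gradient h y⟫_ℝ + κ * FunctionSpaces.Torus.laplacian h y)) + ∫ y, h y * h y)) ≤
        scalarL2Sq (θ t) / 2 +
        2 * Real.sqrt (∫ s in (t - S)..t, κ * (eScalarGradNormSq (θ s)).toReal) *
          (∫ s in (t - S)..t, if 0 < s then Real.sqrt (eScalarDissipation κ (ϑ (⌈s / δ⌉₊ - 1)) 0 S).toReal else 0) +
        (∫ s in (t - S)..t, if 0 < s then Real.sqrt (eScalarDissipation κ (ϑ (⌈s / δ⌉₊ - 1)) 0 S).toReal else 0) ^ 2 +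
        (((∫ s in (t - S)..(t - S + δ), (1 + (∫ y, h y ^ 2) * scalarL2Sq (θ s)) / 2) +
            ∫ s in (t - δ)..t, (1 + (∫ y, h y ^ 2) * scalarL2Sq (θ s)) / 2) +
          δ * (∫ s in (t - S)..t, (Cg * (scalarL2Sq (θ s) + ∫ y, ‖u s y‖ ^ 2) / 2 +
            κ * Cl * (1 + scalarL2Sq (θ s)) / 2 + ∫ y, h y ^ 2)) +
          (3 / 2) * δ * S * (∫ y, h y ^ 2) +
          2 * δ * S * ((Cg * (∫ y, h y ^ 2) / 2 + κ * Cl * (1 + ∫ y, h y ^ 2) / 2) * S +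
            Cg / 2 * ∫ s in (t - S)..t, ∫ y, ‖u s y‖ ^ 2)) := by
  have hS : 0 < S := by linarith
  have hCg0 : 0 ≤ Cg := (norm_nonneg _).trans (hCg 0)
  have hCl0 : 0 ≤ Cl := (abs_nonneg _).trans (hCl 0)
  have hH20 : 0 ≤ ∫ y, h y ^ 2 := integral_nonneg fun _ => sq_nonneg _
  have hhh : ∫ y, h y * h y = ∫ y, h y ^ 2 := integral_congr_ae (Eventually.of_forall fun y => (sq (h y)).symm)
  have hcC : ∀ n, (eScalarDissipation κ (ϑ n) 0 S).toReal ≤ (∫ y, h y ^ 2) / 2 := fun n => by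
    have h1 := ((hrel n).toReal_eScalarDissipation_le_half hκ (hh.memLp 2)
      (lintegral_rpow_half_translate_lt_top hG (by positivity) (by linarith : (0 : ℝ) < S + 1)) (by linarith : S ≤ S + 1)).2
    linarith
  have hsqC : ∀ n, |Real.sqrt (eScalarDissipation κ (ϑ n) 0 S).toReal| ≤ Real.sqrt ((∫ y, h y ^ 2) / 2) := fun n => by
    rw [abs_of_nonneg (Real.sqrt_nonneg _)]; exact Real.sqrt_le_sqrt (hcC n)
  -- ### a.e. facts in the observation time
  have hG0 : ∀ᵐ t ∂(volume : Measure ℝ), t ∉ Set.range (fun n : ℕ => δ * n) := (Set.countable_range _).ae_notMem _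
  have hG1 : ∀ᵐ t ∂(volume : Measure ℝ), t ∈ Ioi (0 : ℝ) → MemLp (θ t) 2 volume := by
    rw [← ae_restrict_iff' measurableSet_Ioi]; exact ae_memLp_two_Ioi hθ
  have hG2 := ae_forall_release_slice hh hrel hsq
  have hG3 := ae_forall_scalar_release_pairing hκ hθ hθ₀ hh hG hδ hS hrel hB
  have hG4 := ae_forall_release_release_pairing hκ hh hG hδ hS hrel hB
  rw [ae_restrict_iff' measurableSet_Ioi]
  filter_upwards [hG0, hG1, hG2, hG3, hG4] with t ht0 ht1 ht2 ht3 ht4 htS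
  have htS' : S + δ < t := htS
  have ht0' : 0 < t := by linarith
  -- ### the grid points in `[t - S + δ, t)`
  obtain ⟨hin, hi01, -, hL2, hx0, hx1, hi₀⟩ :=
    AgeDecoupling.grid_count hδ (by linarith : δ ≤ S - δ) (by linarith : S - δ + 2 * δ < t)
  set i₀ : ℕ := ⌈(t - (S - δ)) / δ⌉₊ with hi₀def
  set i₁ : ℕ := ⌈t / δ⌉₊ with hi₁def
  set L : ℕ := i₁ - i₀ with hLdef
  set n₀ : ℕ := i₀ - 1 with hn₀
  have hi₀n : i₀ = n₀ + 1 := by omega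
  have hi₀r : (i₀ : ℝ) = n₀ + 1 := by exact_mod_cast hi₀n
  have hcast : ∀ j : ℕ, ((i₀ : ℝ) + j) = ((n₀ + j : ℕ) : ℝ) + 1 := fun j => by push_cast; linarith
  have hp : ∀ j, j < L → t - (S - δ) ≤ δ * (i₀ + j) ∧ δ * (i₀ + j) < t := fun j hj => by
    have := hin (i₀ + j) (by omega) (by omega); push_cast at this; exact this
  have hLS : δ * L ≤ S := by linarith
  have hx1' : t - δ ≤ δ * i₀ - δ + δ * L := by
    have hLr : (L : ℝ) = i₁ - i₀ := by rw [hLdef, Nat.cast_sub hi01]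
    have h1 : t ≤ δ * i₁ := by
      calc t = δ * (t / δ) := (mul_div_cancel₀ t hδ.ne').symm
        _ ≤ δ * i₁ := mul_le_mul_of_nonneg_left (Nat.le_ceil _) hδ.le
    rw [hLr]; linarith
  have hx0' : δ * i₀ < t - (S - δ) + δ := by
    have h1 : (i₀ : ℝ) < (t - (S - δ)) / δ + 1 := Nat.ceil_lt_add_one (div_nonneg (by linarith) hδ.le)
    calc δ * (i₀ : ℝ) < δ * ((t - (S - δ)) / δ + 1) := mul_lt_mul_of_pos_left h1 hδ
      _ = t - (S - δ) + δ := by field_simp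
  have hx01 : δ * i₀ - δ ≤ δ * i₀ - δ + δ * L := le_add_of_nonneg_right (mul_nonneg hδ.le (Nat.cast_nonneg L))
  -- ages of the releases at the grid points
  have hage : ∀ j, j < L → 0 < t - δ * ((n₀ + j : ℕ) + 1) ∧ t - δ * ((n₀ + j : ℕ) + 1) ≤ S - δ := fun j hj => by
    rw [← hcast j]; constructor <;> linarith [(hp j hj).1, (hp j hj).2]
  -- ### the deterministic data of the releases
  have hdata := fun j (hj : j < L) =>
    release_data_at (S := S) hκ hh hCg hCl hEu hδ (hrel (n₀ + j)) (hsq (n₀ + j)) (hage j hj).1.le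
      (by linarith [(hage j hj).2]) (by linarith)
  -- ### the finite-sum assembly
  refine AgeDecoupling.window_ineq_of_grid (L := L) (i₀ := i₀)
    (Pr := fun j s => (∫ y, h y * h y) + ∫ r in Ioc 0 s, ∫ y, ϑ (n₀ + j) r y *
      (⟪u (δ * ((n₀ + j : ℕ) + 1) + r) y, FunctionSpaces.Torus.gradient h y⟫_ℝ + κ * FunctionSpaces.Torus.laplacian h y))
    (kr := fun j r => Cg * ((∫ y, h y ^ 2) + ∫ y, ‖u (δ * ((n₀ + j : ℕ) + 1) + r) y‖ ^ 2) / 2 +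
      κ * Cl * (1 + ∫ y, h y ^ 2) / 2)
    (a := fun j => ∫ x, θ t x * ϑ (n₀ + j) (t - δ * ((n₀ + j : ℕ) + 1)) x)
    (Asq := fun j => scalarL2Sq (ϑ (n₀ + j) (t - δ * ((n₀ + j : ℕ) + 1))))
    (w := fun j => Real.sqrt (eScalarDissipation κ (ϑ (n₀ + j)) 0 S).toReal)
    (gg := fun j j' => ∫ x, ϑ (n₀ + j) (t - δ * ((n₀ + j : ℕ) + 1)) x * ϑ (n₀ + j') (t - δ * ((n₀ + j' : ℕ) + 1)) x)
    hδ hH20 ?_ (fun j => Real.sqrt_nonneg _) hLS (fun j hj => by linarith [(hp j hj).2]) ?_ ?_ ?_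
    (fun j x => ?_) (fun j hj => by rw [hcast j]; exact (hdata j hj).1) (fun j hj => by rw [hcast j]; exact (hdata j hj).2.1)
    (fun j hj => by rw [hcast j]; exact (hdata j hj).2.2.1) (fun j hj => by rw [hcast j]; exact (hdata j hj).2.2.2)
    ?_ ?_ ?_ ?_ ?_ ?_
  · -- `0 ≤ K_r`
    have h1 : 0 ≤ ∫ s in (t - S)..t, ∫ y, ‖u s y‖ ^ 2 :=
      intervalIntegral.integral_nonneg (by linarith) fun s _ => integral_nonneg fun _ => sq_nonneg _
    have h2 : 0 ≤ κ * Cl := mul_nonneg hκ.le hCl0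
    have h3 : 0 ≤ Cg * (∫ y, h y ^ 2) / 2 + κ * Cl * (1 + ∫ y, h y ^ 2) / 2 :=
      add_nonneg (div_nonneg (mul_nonneg hCg0 hH20) zero_le_two) (div_nonneg (mul_nonneg h2 (by linarith)) zero_le_two)
    exact add_nonneg (mul_nonneg h3 hS.le) (mul_nonneg (div_nonneg hCg0 zero_le_two) h1)
  · -- the number of later grid points
    intro j hj
    have h1 := AgeDecoupling.floor_sub_div_eq hδ ht0 (k := i₀ + j) (by omega)
    push_cast at h1
    rw [h1]
    omega
  · -- (A1): the scalar/release pairings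
    intro j hj
    rw [hcast j]
    have e1 := ht3 (n₀ + j) (by linarith) (hage j hj).1 (by linarith [(hage j hj).2])
    have e2 := IsWeakScalarTransportOn.setIntegral_pairing_eq_integral_releaseTrace (hrel (n₀ + j)) hh (hage j hj).1.le
      (by linarith [(hage j hj).2] : t - δ * ((n₀ + j : ℕ) + 1) ≤ S + 1)
    rw [e2] at e1
    exact e1
  · -- `P_j(0) = H₂`
    intro j _
    simp only [Ioc_self, Measure.restrict_empty, integral_zero_measure, add_zero]
    exact hhh
  · -- `0 ≤ k_j`
    have h1 : 0 ≤ ∫ y, ‖u (δ * ((n₀ + j : ℕ) + 1) + x) y‖ ^ 2 := integral_nonneg fun _ => sq_nonneg _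
    have h2 : 0 ≤ κ * Cl := mul_nonneg hκ.le hCl0
    exact add_nonneg (div_nonneg (mul_nonneg hCg0 (add_nonneg hH20 h1)) zero_le_two)
      (div_nonneg (mul_nonneg h2 (by linarith)) zero_le_two)
  · -- (A3): the release/release pairings
    intro j m hjm
    have hage' : 0 < t - δ * ((n₀ + j + m + 1 : ℕ) + 1) := by
      have h1 := (hp (j + m + 1) hjm).2
      rw [hi₀r] at h1
      push_cast at h1 ⊢
      linarith
    have e := ht4 (n₀ + j) m hage' (by linarith [(hage j (by omega)).2])
    have en : n₀ + (j + m + 1) = n₀ + j + m + 1 := by omega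
    rw [en]
    exact e
  · -- (A4): completing the square
    have hθt : MemLp (θ t) 2 volume := ht1 ht0'
    have hAmem : ∀ j ∈ Finset.range L, MemLp (ϑ (n₀ + j) (t - δ * ((n₀ + j : ℕ) + 1))) 2 volume := fun j hj => by
      rw [Finset.mem_range] at hj
      exact (ht2 (n₀ + j) ⟨(hage j hj).1, by linarith [(hage j hj).2]⟩).1
    have h1 := AgeDecoupling.sum_integral_mul_sub_upper_le (Finset.range L) δ hθt hAmem
    have e2 : ∀ f : UnitAddTorus d → ℝ, ∫ x, f x ^ 2 = scalarL2Sq f := fun f => rfl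
    have e3 : ∑ i ∈ Finset.range L, ∫ x, ϑ (n₀ + i) (t - δ * ((n₀ + i : ℕ) + 1)) x ^ 2 =
        ∑ j ∈ Finset.range L, scalarL2Sq (ϑ (n₀ + j) (t - δ * ((n₀ + j : ℕ) + 1))) := Finset.sum_congr rfl fun j _ => e2 _
    rw [e2, e3] at h1
    linarith
  · -- `‖A_j‖² ≤ H₂`
    intro j hj
    exact (ht2 (n₀ + j) ⟨(hage j hj).1, by linarith [(hage j hj).2]⟩).2
  · -- (A5): the left Riemann sum of `P`
    refine (abs_sum_trace_sub_integral_le hκ.le hθ hh hCg hCl hEu hδ hi₀ L).trans (mul_le_mul_of_nonneg_left ?_ hδ.le)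
    have hK0 : ∀ s, 0 ≤ Cg * (scalarL2Sq (θ s) + ∫ y, ‖u s y‖ ^ 2) / 2 + κ * Cl * (1 + scalarL2Sq (θ s)) / 2 + ∫ y, h y ^ 2 :=
      fun s => by
      have h1 : 0 ≤ scalarL2Sq (θ s) := integral_nonneg fun _ => sq_nonneg _
      have h2 : 0 ≤ ∫ y, ‖u s y‖ ^ 2 := integral_nonneg fun _ => sq_nonneg _
      have h3 : 0 ≤ κ * Cl := mul_nonneg hκ.le hCl0
      exact add_nonneg (add_nonneg (div_nonneg (mul_nonneg hCg0 (add_nonneg h1 h2)) zero_le_two)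
        (div_nonneg (mul_nonneg h3 (by linarith)) zero_le_two)) hH20
    refine intervalIntegral.integral_mono_interval (by linarith) hx01 hx1.le (ae_of_all _ hK0) ?_
    exact (intervalIntegrable_iff_integrableOn_Ioc_of_le (by linarith)).2
      ((integrableOn_traceMajorant hθ hEu ht0').mono_set (Ioc_subset_Ioc_left (by linarith)))
  · -- the end bits of the window
    exact window_sub_cells_le hθ hh (by linarith) (by linarith) hx01 hx1.le (by linarith) (by linarith) hx1'
  · -- the release weights are a window of the grid step function
    exact mul_sum_sqrt_le_window (c := fun n => (eScalarDissipation κ (ϑ n) 0 S).toReal) hδ (Real.sqrt_nonneg _) hsqC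
      hi₀ L (by linarith : t - S ≤ δ * i₀ - δ) hx1.le

end Window

end Torus

end Literature.Analysis.FluidPDE
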